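import Literature.GroupTheory.Index.InfiniteIndexSupergroup
import HarnessLib

/-!
# A subgroup which together with the squares generates a finitely generated abelian group has finite index

If `Λ` is a finitely generated abelian group and `M ⊆ Λ` a subgroup such that every element of `Λ` is
of the form `m + 2 y` with `m ∈ M` (i.e. `M + 2Λ = Λ`), then `M` has finite index
(`AddSubgroup.index_ne_zero_of_forall_exists_add_two_nsmul`): the quotient `Λ/M` is a finitely
generated abelian group in which every element is divisible by `2`, hence finite — an infinite one
surjects onto `ℤ` (`exists_addMonoidHom_int_surjective_of_infinite`), where `1` is not a double. The
multiplicative transport `Subgroup.index_ne_zero_of_forall_exists_mul_sq` is the form used for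
fundamental groups of topological groups (commutative `Group`s isomorphic to `Multiplicative` of a
finitely generated abelian group via the Hurewicz isomorphism): there it reads "if the monodromy
`π₁ → G[2]` of the squaring covering maps `M` ONTO `G[2]`, then `M` has finite index", the last step of
the proof that `(f^P)_* π₁(C(ℂ))` has finite index in `π₁(J(ℂ))` (towards
`Literature.AlgebraicGeometry.Motives.isIso_bettiCohomology_map_abelJacobi`). Everything is proved.
-/

namespace Literature.GroupTheory.Index

open Function

/-- **`M + 2Λ = Λ` forces `[Λ : M] < ∞`** for a finitely generated abelian group `Λ`: the quotient
`Λ/M` is finitely generated and `2`-divisible, hence finite (an infinite finitely generated abelian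
group maps onto `ℤ`, in which `1` is not divisible by `2`). [folklore] -/
theorem AddSubgroup.index_ne_zero_of_forall_exists_add_two_nsmul {Λ : Type*} [AddCommGroup Λ]
    [AddGroup.FG Λ] (M : AddSubgroup Λ) (h : ∀ x : Λ, ∃ m ∈ M, ∃ y : Λ, x = m + 2 • y) :
    M.index ≠ 0 := by
  intro hM
  haveI : AddGroup.FG (Λ ⧸ M) := QuotientAddGroup.fg M
  haveI : Infinite (Λ ⧸ M) := AddSubgroup.index_eq_zero_iff_infinite.mp hM
  obtain ⟨π, hπ⟩ := exists_addMonoidHom_int_surjective_of_infinite (Q := Λ ⧸ M)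
  obtain ⟨q, hq⟩ := hπ 1
  obtain ⟨x, rfl⟩ := QuotientAddGroup.mk_surjective q
  obtain ⟨m, hm, y, rfl⟩ := h x
  have h2 : π (QuotientAddGroup.mk (s := M) (m + 2 • y)) = 2 * π (QuotientAddGroup.mk (s := M) y) := by
    rw [QuotientAddGroup.mk_add, (QuotientAddGroup.eq_zero_iff m).mpr hm, zero_add,
      QuotientAddGroup.mk_nsmul, map_nsmul, nsmul_eq_mul, Nat.cast_ofNat]
  rw [h2] at hq
  omega

/-- **Multiplicative transport**: for a group `G` isomorphic to `Multiplicative Λ`, `Λ` a finitely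
generated abelian group, a subgroup `M` with `G = M · G²` (every element is `m y²`, `m ∈ M`) has finite
index. [folklore] -/
theorem Subgroup.index_ne_zero_of_forall_exists_mul_sq {G Λ : Type*} [Group G] [AddCommGroup Λ]
    [AddGroup.FG Λ] (e : G ≃* Multiplicative Λ) (M : Subgroup G)
    (h : ∀ g : G, ∃ m ∈ M, ∃ y : G, g = m * y ^ 2) : M.index ≠ 0 := by
  set M' : AddSubgroup Λ := AddSubgroup.toSubgroup.symm (M.map (e : G →* Multiplicative Λ)) with hM'
  have hidx : M'.index = M.index := by
    rw [hM', ← AddSubgroup.index_toSubgroup, OrderIso.apply_symm_apply, Subgroup.index_map_equiv]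
  rw [← hidx]
  refine AddSubgroup.index_ne_zero_of_forall_exists_add_two_nsmul M' fun x => ?_
  obtain ⟨m, hm, y, hy⟩ := h (e.symm (Multiplicative.ofAdd x))
  refine ⟨Multiplicative.toAdd (e m), ?_, Multiplicative.toAdd (e y), ?_⟩
  · change Multiplicative.toAdd ((e : G →* Multiplicative Λ) m) ∈
      AddSubgroup.toSubgroup.symm (M.map (e : G →* Multiplicative Λ))
    rw [← Multiplicative.mem_toSubgroup, OrderIso.apply_symm_apply]
    exact Subgroup.mem_map_of_mem _ hm
  · apply Multiplicative.ofAdd.injective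
    apply e.symm.injective
    rw [hy, ofAdd_add, ofAdd_nsmul, ofAdd_toAdd, ofAdd_toAdd, map_mul, map_pow, e.symm_apply_apply,
      e.symm_apply_apply]

end Literature.GroupTheory.Index
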